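import Literature.MathematicalPhysics.QuantumFieldTheory.Balaban1983to89.B9Eq321LandauProjectionZd
import Literature.MathematicalPhysics.QuantumFieldTheory.Balaban1983to89.T4TermwiseTorus

/-!
# `Balaban1983to89.B9Eq321LandauProjectionZdPer` — [Balaban1985BackgroundPropagators] (3.20)–(3.22) p. 394 ON THE TORUS: THE GAUGE-FIXING PROJECTION
# `R(U₀)` on the `P`-PERIODIC functions `ℤᵈ → 𝔸` (the torus `T_P` read on its universal cover, [Balaban1985RegularSpaces] p. 77 «Ω₀ = T_η») — the periodic
# twin of `B9Eq321LandauProjectionZd` (Dirichlet reading on a finite `Ω₀`): the real pairing space of periodic functions with `Σ_{x ∈ [0,P)ᵈ} Re τ(f(x)* g(x))`,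
# the periodic null space `N_𝔤^per(Q′(U₀))`, the subspace `Δ^η_{U₀}N_𝔤^per(Q′(U₀))`, and the orthogonal projection onto it

statement-level skeleton of published theorems with citation tags; proofs where landed; nothing here is a claim about the
Yang–Mills mass gap

`[Balaban1985BackgroundPropagators]` ("B9", CMP **99** (1985) 389–434) p. 394: *«R = R(U) is an orthogonal projection in the Hilbert space L²(Ω₀, g)
onto the subspace R = Δ^η_U N(Q′), N(Q′) = {λ : Q′λ = 0}. (3.21) For an arbitrary function f ∈ L²(Ω₀, g) we have Rf = Δ^η_U λ₀, where λ₀ is a minimum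
of the function λ ∈ N(Q′), λ → ‖f − Δ^η_U λ‖². (3.22)»*; `[Balaban1985RegularSpaces]` ("B8", CMP **98** (1985) 17–51 ∕ 65–…) p. 77: *«Let us take
Ω₀ = T_η»* — the whole torus is a legitimate `Ω₀`, on which «supported in Ω₀» is no condition and the finite-dimensionality of `L²(Ω₀, 𝔤)` comes from
PERIODICITY instead of finite support.  PDF held: `paper:balaban1985-cmp99-background-propagators` pp. 392–395.

CITATION HEADER (lean-in-tree rule).  Cell `pub-ymgap` (YM Track A), DAG node N06 = [B9], width seat `pub-ymgap-dag-n06-w4` (g5), the (β′-PERIODIC) road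
of director-ym №217 (1) ∕ plan g86 PENS-217 («N06 side: (β′) asks `gopZd ∕ projE` on the periodic subspace with `Module.Finite` in place of
`(Ω 0).Finite`»); sibling dag-n06-b g22 types the periodic GREEN letter (`B9Eq327GreenZdHermPer`, Hermitian bond fields) — this file is the periodic
PROJECTION letter on site functions; the torus bookkeeping (`IsPeriodic ∕ box ∕ tcls ∕ tlift`) is `T4TermwiseTorus`'s (dag-n05-c's choice for P1), the
pairing `trForm τ s` and the stencils `covLap ∕ QprimeIter ∕ bgT` are the Dirichlet file's vocabulary — nothing is re-declared.

WHAT IS DECLARED ∕ PROVED (kernel, 0 sorry; definitions with bodies + theorems; no `instance`, no `notation`).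
* §1 `perSub P` (the real subspace of `P`-periodic functions `ℤᵈ → 𝔸`; `finiteDimensional_perSub` for `P ≠ 0` and a finite-dimensional fibre —
  restriction to the box `[0,P)ᵈ` is injective), `perRestrict P f` (`x ↦ f(x mod P)`: the periodisation-by-representatives of any `f`, periodic, `= f`
  on periodic `f`), `formPer τ P` (= `trForm τ (box P)` restricted to `perSub P`: the torus pairing `Σ_{x ∈ [0,P)ᵈ} Re τ(f(x)* g(x))`), `formPer_isSymm`
  (Hermitian `τ`), `formPer_apply_self_eq_zero` ∕ `restrict_formPer_nondegenerate` (faithful `τ`: vanishing on the box + periodicity ⇒ `f = 0`).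
* §2 `isPeriodic_conj_apply`-type transport: `isPeriodic_covDerivFwd`, `isPeriodic_covDeriv`, `isPeriodic_covDivB`, ★ `isPeriodic_covLap` (for
  `P`-periodic `U₀` and `f`, `Δ^η_{U₀}f` is `P`-periodic — the stencils commute with the deck translations `x ↦ x + P·m`).
* §3 `gaugeNullPer P L m Λs U₀` = `N_𝔤^per(Q′(U₀))` (Hermitian-valued, `P`-PERIODIC `λ` with `Q′_j(U₀)λ = 0` on `Λs j`, `j ≤ m`), `rangeGenPer` ∕
  `rangeSubPer` (= `Δ^η_{U₀}N_𝔤^per(Q′(U₀))` in `perSub P`, the span of the `Δ^η_{U₀}λ`), `covLap_mem_rangeGenPer` (non-vacuity: every `λ ∈ N_𝔤^per`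
  contributes a generator when `U₀` is `P`-periodic); ★ `projEPer τ P L m η Λs U₀` = THE ORTHOGONAL PROJECTION onto `rangeSubPer` along its
  `formPer`-orthogonal complement (`projEPer_eq_projection` under the `τ`-hypotheses via Mathlib's `isCompl_orthogonal_of_restrict_nondegenerate`;
  `projEPer_apply_of_mem_orthogonal` = 0, `projEPer_apply_of_mem_range` = id, `projEPer_apply_mem_range`, `projEPer_isIdempotentElem` (`R² = R`),
  `formPer_projEPer_symm` (`⟨Rf, g⟩ = ⟨f, Rg⟩`)), `projRPer` (the same on all functions: periodise by representatives, project, read back).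
* §4 A6: `isCompl_rangeSubPer_orthogonal_complex` ∕ `projEPer_isIdempotentElem_complex` (the abelian fibre `𝔸 = ℂ`, `τ = id`: every `τ`-hypothesis discharged).

HONEST SCOPE.  (i) OBJECTS and finite-dimensional linear algebra only: (3.24) ∕ Thm 3.1 ∕ Thm 3.11 are NOT proved; no estimate uniform in `P` (N06's
debt is unchanged in kind).  (ii) READING: as in the Dirichlet file — the projection of `𝔸`-valued periodic functions onto the `𝔤`-valued subspace
`Δ^η_{U₀}N_𝔤^per(Q′(U₀))` for the pairing `Re τ(a*b)` over one fundamental box; on `𝔤`-valued arguments and unitary periodic `U₀` this is (3.21)–(3.22) on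
`Ω₀ = T_P` verbatim (the positive weight `η^d` of p. 393 does not change the projection).  (iii) The periodic twin of the RECORD edit `opsLandau` is NOT
made here (the (β′) record surgery is dag-n06-b's `withGopZdHPer`; a consumer composes `projEPer` there).  (iv) Count-neutral; N05 ∕ N06 NOT discharged;
K1⁹ `stmt-QuantumFields-27364` NOT closed; one finite `𝕋⁴` programme at fixed `ε`, Bałaban as printed; R4 closes only the conditional finite-`𝕋⁴` rung
`BalabanLadder.UV` — nothing continuum ∕ ℝ⁴ ∕ OS ∕ mass gap ∕ Clay.  Unit `pub-ymgap-dag-n06-w4` (g5), 2026-08-28.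
-/

noncomputable section

namespace Literature.MathematicalPhysics.QuantumFieldTheory.Balaban1983to89.B9Eq321LandauProjectionZdPer

open B7Prop1Explicit B7Eq78Linearization
open B8Ineq132 (covDeriv covDerivFwd)
open B8Eq119TwistedAxial (bgT)
open B8Eq138LandauZd (covDivB covLap)
open T4TermwiseTorus (IsPeriodic box tcls tlift tlift_mem_box tcls_add tcls_period)
open B9Eq321LandauProjectionZd (trForm trForm_apply)

-- `Site` alone could resolve to the torus sites of `Setup.lean`; re-export the `ℤ^d` sites of `B7Prop1Explicit`.
export B7Prop1Explicit (Site)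

variable {d : ℕ} {𝔸 : Type*} [CStarAlgebra 𝔸]

/-! ## §1  The real pairing space of `P`-periodic functions: `L²(T_P, ·)` read on `ℤᵈ` -/

section Space

variable (τ : 𝔸 →ₗ[ℂ] ℂ) (P : ℕ)

/-- **THE CARRIER OF `L²(T_P, ·)`**: the real subspace of `P`-periodic functions `ℤᵈ → 𝔸` (`f(x + P·m) = f(x)`) — functions on the torus `Ω₀ = T_P` read on its
universal cover. [cite: Balaban1985BackgroundPropagators, (3.21) p.394 («the Hilbert space L²(Ω₀, 𝔤)»); Balaban1985RegularSpaces, p.77 («Ω₀ = T_η»)] -/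
def perSub : Submodule ℝ (Site d → 𝔸) where
  carrier := {f | IsPeriodic P f}
  add_mem' := by
    intro f g hf hg x m
    rw [Pi.add_apply, Pi.add_apply, hf x m, hg x m]
  zero_mem' := fun _ _ => rfl
  smul_mem' := by
    intro c f hf x m
    rw [Pi.smul_apply, Pi.smul_apply, hf x m]

/-- membership in `perSub P`, unfolded. [cite: Balaban1985BackgroundPropagators, (3.21) p.394 (bookkeeping)] -/
theorem mem_perSub_iff (f : Site d → 𝔸) : f ∈ perSub (𝔸 := 𝔸) P ↔ IsPeriodic P f := Iff.rfl

/-- **PERIODISATION BY REPRESENTATIVES**: `x ↦ f(x̄)`, `x̄ ∈ [0,P)ᵈ` the representative of `x mod P` (the torus analogue of the Dirichlet file's `𝟙_{Ω₀}·f`).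
[cite: Balaban1985BackgroundPropagators, (3.24) p.394 («↾Ω₀», periodic reading); Balaban1985RegularSpaces, p.77] -/
def perRestrict (f : Site d → 𝔸) : Site d → 𝔸 := fun x => f (tlift (tcls P x))

omit [CStarAlgebra 𝔸] in
/-- `perRestrict P f` is `P`-periodic. [cite: Balaban1985RegularSpaces, p.77 («Ω₀ = T_η», bookkeeping)] -/
theorem isPeriodic_perRestrict (f : Site d → 𝔸) : IsPeriodic P (perRestrict (𝔸 := 𝔸) P f) := by
  intro x m
  show f (tlift (tcls P (x + (P : ℤ) • m))) = f (tlift (tcls P x))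
  rw [tcls_add, tcls_period, add_zero]

/-- `perRestrict P f ∈ perSub P`. [cite: Balaban1985RegularSpaces, p.77 (bookkeeping)] -/
theorem perRestrict_mem_perSub (f : Site d → 𝔸) : perRestrict P f ∈ perSub (𝔸 := 𝔸) P := isPeriodic_perRestrict P f

omit [CStarAlgebra 𝔸] in
/-- on a periodic `f`, `perRestrict P f = f` (`P ≠ 0`). [cite: Balaban1985RegularSpaces, p.77 (bookkeeping)] -/
theorem perRestrict_eq_self [NeZero P] {f : Site d → 𝔸} (hf : IsPeriodic P f) : perRestrict P f = f :=
  funext fun x => hf.apply_tlift x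

/-- **`perSub P` IS FINITE-DIMENSIONAL** over `ℝ` when the fibre is and `P ≠ 0` (restriction to the box `[0,P)ᵈ` is injective on periodic functions) —
the «Module.Finite in place of (Ω 0).Finite» of the periodic road. [cite: Balaban1985RegularSpaces, p.77 («Ω₀ = T_η» is finite)] -/
theorem finiteDimensional_perSub [FiniteDimensional ℝ 𝔸] [NeZero P] : FiniteDimensional ℝ (perSub (𝔸 := 𝔸) (d := d) P) := by
  let res : (perSub (𝔸 := 𝔸) (d := d) P) →ₗ[ℝ] ((↥(box (d := d) P)) → 𝔸) :=
    { toFun := fun f x => (f : Site d → 𝔸) x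
      map_add' := fun f g => rfl
      map_smul' := fun c f => rfl }
  refine FiniteDimensional.of_injective res fun f g h => ?_
  apply Subtype.ext
  funext x
  have hfg := congr_fun h ⟨tlift (tcls P x), tlift_mem_box _⟩
  have hf : (f : Site d → 𝔸) (tlift (tcls P x)) = (f : Site d → 𝔸) x := IsPeriodic.apply_tlift f.2 x
  have hg : (g : Site d → 𝔸) (tlift (tcls P x)) = (g : Site d → 𝔸) x := IsPeriodic.apply_tlift g.2 x
  rw [← hf, ← hg]
  exact hfg

/-- **THE PAIRING ON `L²(T_P, ·)`**: `Σ_{x ∈ [0,P)ᵈ} Re τ(f(x)* g(x))` — the Dirichlet file's `trForm τ (box P)` restricted to `perSub P` (print's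
«⟨λ, λ′⟩ = Σ_{x∈Ω₀} η^d tr λ(x)λ′(x)», p. 393, over one fundamental domain of the torus, the positive weight dropped).
[cite: Balaban1985BackgroundPropagators, (3.17) p.393, (3.21) p.394; Balaban1985RegularSpaces, p.77] -/
def formPer : LinearMap.BilinForm ℝ (perSub (𝔸 := 𝔸) (d := d) P) := (trForm τ (box P)).restrict (perSub P)

/-- the pairing, unfolded. [cite: Balaban1985BackgroundPropagators, (3.17) p.393 (bookkeeping)] -/
theorem formPer_apply (f g : perSub (𝔸 := 𝔸) (d := d) P) :
    formPer τ P f g = ∑ x ∈ box P, (τ (star ((f : Site d → 𝔸) x) * (g : Site d → 𝔸) x)).re := rfl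

/-- **SYMMETRY** for a Hermitian trace (`τ(a*) = conj τ(a)`). [cite: Balaban1985BackgroundPropagators, p.391 (the scalar product is symmetric)] -/
theorem formPer_isSymm (hτs : ∀ a : 𝔸, τ (star a) = starRingEnd ℂ (τ a)) : (formPer τ (d := d) P).IsSymm := by
  refine ⟨fun f g => ?_⟩
  rw [formPer_apply, formPer_apply]
  refine Finset.sum_congr rfl fun x _ => ?_
  have h : star ((g : Site d → 𝔸) x) * (f : Site d → 𝔸) x = star (star ((f : Site d → 𝔸) x) * (g : Site d → 𝔸) x) := by
    rw [star_mul, star_star]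
  rw [h, hτs, Complex.conj_re]

/-- **POSITIVE-DEFINITENESS** for a faithful positive trace (`Re τ(a*a) > 0` for `a ≠ 0`) and `P ≠ 0`: `⟨f, f⟩ = 0` only for `f = 0` — vanishing on the
fundamental box and periodicity. [cite: Balaban1985BackgroundPropagators, (3.21) p.394 («the Hilbert space L²(Ω₀, 𝔤)»); Balaban1985RegularSpaces, p.77] -/
theorem formPer_apply_self_eq_zero [NeZero P] (hτp : ∀ a : 𝔸, a ≠ 0 → 0 < (τ (star a * a)).re) {f : perSub (𝔸 := 𝔸) (d := d) P}
    (h : formPer τ P f f = 0) : f = 0 := by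
  rw [formPer_apply] at h
  have hnn : ∀ x ∈ box (d := d) P, 0 ≤ (τ (star ((f : Site d → 𝔸) x) * (f : Site d → 𝔸) x)).re := by
    intro x _
    by_cases ha : (f : Site d → 𝔸) x = 0
    · rw [ha, mul_zero, map_zero, Complex.zero_re]
    · exact (hτp _ ha).le
  have hx : ∀ x ∈ box (d := d) P, (τ (star ((f : Site d → 𝔸) x) * (f : Site d → 𝔸) x)).re = 0 :=
    (Finset.sum_eq_zero_iff_of_nonneg hnn).1 h
  apply Subtype.ext
  funext x
  have hf : (f : Site d → 𝔸) (tlift (tcls P x)) = (f : Site d → 𝔸) x := IsPeriodic.apply_tlift f.2 x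
  rw [← hf, Submodule.coe_zero, Pi.zero_apply]
  by_contra hne
  exact (hτp _ hne).ne' (hx _ (tlift_mem_box _))

/-- **NONDEGENERACY ON EVERY SUBSPACE** of `L²(T_P, ·)`. [cite: Balaban1985BackgroundPropagators, (3.21) p.394 («the Hilbert space L²(Ω₀, 𝔤)»)] -/
theorem restrict_formPer_nondegenerate [NeZero P] (hτp : ∀ a : 𝔸, a ≠ 0 → 0 < (τ (star a * a)).re)
    (W : Submodule ℝ (perSub (𝔸 := 𝔸) (d := d) P)) : ((formPer τ P).restrict W).Nondegenerate := by
  refine ⟨fun w hw => ?_, fun w hw => ?_⟩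
  · have h := hw w
    rw [LinearMap.BilinForm.restrict_apply, LinearMap.domRestrict_apply] at h
    exact Subtype.ext (formPer_apply_self_eq_zero τ P hτp h)
  · have h := hw w
    rw [LinearMap.BilinForm.restrict_apply, LinearMap.domRestrict_apply] at h
    exact Subtype.ext (formPer_apply_self_eq_zero τ P hτp h)

end Space

/-! ## §2  The stencils commute with the deck translations: `Δ^η_{U₀}` preserves `P`-periodicity for `P`-periodic `U₀` -/

section Transport

variable {P : ℕ} {η : ℝ} {U₀ : Site d → Fin d → 𝔸ˣ} {f : Site d → 𝔸}

omit [CStarAlgebra 𝔸] in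
/-- a `P`-periodic bond field has `P`-periodic components: `U₀(x + P·m, μ) = U₀(x, μ)`. [cite: Balaban1985RegularSpaces, p.77 («Ω₀ = T_η», bookkeeping)] -/
theorem apply_add_zsmul_of_isPeriodic {β : Type*} {V : Site d → Fin d → β} (hV : IsPeriodic P V) (x m : Site d) (μ : Fin d) :
    V (x + (P : ℤ) • m) μ = V x μ := by
  rw [hV x m]

/-- **`D^η_{U₀,μ}` (forward) PRESERVES PERIODICITY**: for `P`-periodic `U₀` and `f`, `D^η_{U₀,μ}f` is `P`-periodic.
[cite: Balaban1985BackgroundPropagators, (3.23) p.394; Balaban1985RegularSpaces, p.77 («Ω₀ = T_η»)] -/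
theorem isPeriodic_covDerivFwd (hU : IsPeriodic P U₀) (hf : IsPeriodic P f) (μ : Fin d) : IsPeriodic P (covDerivFwd η U₀ μ f) := by
  intro x m
  unfold covDerivFwd
  rw [apply_add_zsmul_of_isPeriodic hU, add_right_comm, hf (x + e μ) m, hf x m]

/-- **`D^{η}_{U₀,ν}` (backward) PRESERVES PERIODICITY**. [cite: Balaban1985BackgroundPropagators, (3.23) p.394; Balaban1985RegularSpaces, p.77 («Ω₀ = T_η»)] -/
theorem isPeriodic_covDeriv (hU : IsPeriodic P U₀) (hf : IsPeriodic P f) (ν : Fin d) : IsPeriodic P (covDeriv η U₀ ν f) := by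
  intro x m
  unfold covDeriv
  rw [add_sub_right_comm, apply_add_zsmul_of_isPeriodic hU, hf (x - e ν) m, hf x m]

/-- **`D^{η*}_{U₀}` (the covariant divergence of a bond field) PRESERVES PERIODICITY**. [cite: Balaban1985BackgroundPropagators, (3.23) p.394; Balaban1985RegularSpaces, p.77] -/
theorem isPeriodic_covDivB {A : Site d → Fin d → 𝔸} (hU : IsPeriodic P U₀) (hA : IsPeriodic P A) : IsPeriodic P (covDivB η U₀ A) := by
  intro x m
  unfold covDivB
  refine Finset.sum_congr rfl fun μ _ => ?_
  exact isPeriodic_covDeriv hU (fun z m' => by rw [apply_add_zsmul_of_isPeriodic hA]) μ x m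

/-- ★ **`Δ^η_{U₀}` PRESERVES PERIODICITY**: for `P`-periodic `U₀` and `f`, `Δ^η_{U₀}f = Σ_μ D^{η*}_{U₀,μ}D^η_{U₀,μ}f` is `P`-periodic — the operator of
(3.21)–(3.23) acts on `L²(T_P, ·)`. [cite: Balaban1985BackgroundPropagators, (3.23) p.394; Balaban1985RegularSpaces, p.77 («Ω₀ = T_η»)] -/
theorem isPeriodic_covLap (hU : IsPeriodic P U₀) (hf : IsPeriodic P f) : IsPeriodic P (covLap η U₀ f) := by
  unfold covLap
  exact isPeriodic_covDivB hU fun z m => funext fun μ => isPeriodic_covDerivFwd hU hf μ z m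

/-- `Δ^η_{U₀}f ∈ perSub P` for periodic data. [cite: Balaban1985BackgroundPropagators, (3.21) p.394 (bookkeeping)] -/
theorem covLap_mem_perSub (hU : IsPeriodic P U₀) (hf : IsPeriodic P f) : covLap η U₀ f ∈ perSub (𝔸 := 𝔸) P := isPeriodic_covLap hU hf

end Transport

/-! ## §3  `N_𝔤^per(Q′(U₀))`, `Δ^η_{U₀}N_𝔤^per(Q′(U₀))`, and the orthogonal projection `R(U₀)` of (3.21)–(3.22) on the torus -/

section Projection

variable (τ : 𝔸 →ₗ[ℂ] ℂ) (P L m : ℕ) (η : ℝ) (Λs : ℕ → Set (Site d)) (U₀ : Site d → Fin d → 𝔸ˣ)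

/-- **`N_𝔤^per(Q′(U₀))`** («N(Q′) = {λ : Q′λ = 0}», (3.21), in `L²(T_P, 𝔤)`): Hermitian-valued, `P`-PERIODIC gauge functions with `(Q′_j(U₀)λ)(y) = 0` for
`y ∈ Λs j`, `j ≤ m` (`Q′_j(U₀) = QprimeIter (zdBlocking d L) (bgT L U₀) j`, (3.19)) — the Dirichlet file's `gaugeNull` with periodicity in place of the support clause.
[cite: Balaban1985BackgroundPropagators, (3.21) p.394, (3.18)–(3.19) p.393; Balaban1985RegularSpaces, p.77 («Ω₀ = T_η»)] -/
def gaugeNullPer : Set (Site d → 𝔸) :=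
  {lam | (∀ x, IsSelfAdjoint (lam x)) ∧ IsPeriodic P lam ∧
    ∀ j, j ≤ m → ∀ y ∈ Λs j, QprimeIter (zdBlocking d L) (bgT L U₀) j lam y = 0}

/-- **THE GENERATORS OF `R = Δ^η_{U₀}N^per(Q′)`** read in `L²(T_P, ·)`: the periodic functions `Δ^η_{U₀}λ`, `λ ∈ N_𝔤^per(Q′(U₀))`.
[cite: Balaban1985BackgroundPropagators, (3.21) p.394, (3.23) p.394] -/
def rangeGenPer : Set (perSub (𝔸 := 𝔸) (d := d) P) :=
  {w | ∃ lam ∈ gaugeNullPer P L m Λs U₀, (w : Site d → 𝔸) = covLap η U₀ lam}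

/-- **`R = Δ^η_{U₀}N_𝔤^per(Q′(U₀))`** as a real subspace of `L²(T_P, ·)` (the span of the generators). [cite: Balaban1985BackgroundPropagators, (3.21) p.394] -/
def rangeSubPer : Submodule ℝ (perSub (𝔸 := 𝔸) (d := d) P) := Submodule.span ℝ (rangeGenPer P L m η Λs U₀)

variable {P L m η Λs U₀} in
/-- **NON-VACUITY OF THE GENERATING SET**: for a `P`-periodic `U₀`, every `λ ∈ N_𝔤^per(Q′(U₀))` contributes the generator `Δ^η_{U₀}λ ∈ L²(T_P, ·)`.
[cite: Balaban1985BackgroundPropagators, (3.21) p.394] -/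
theorem covLap_mem_rangeGenPer (hU : IsPeriodic P U₀) {lam : Site d → 𝔸} (hlam : lam ∈ gaugeNullPer P L m Λs U₀) :
    (⟨covLap η U₀ lam, covLap_mem_perSub hU hlam.2.1⟩ : perSub (𝔸 := 𝔸) (d := d) P) ∈ rangeGenPer P L m η Λs U₀ :=
  ⟨lam, hlam, rfl⟩

open Classical in
/-- ★ **`R(U₀)` ON THE TORUS, THE ORTHOGONAL PROJECTION ONTO `Δ^η_{U₀}N^per(Q′(U₀))`** ((3.21)–(3.22)) in `L²(T_P, ·)` for the pairing `formPer τ P`: the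
projection onto `rangeSubPer` along its `formPer`-orthogonal complement (defined whenever the two are complementary — always, for a faithful Hermitian `τ`,
`P ≠ 0` and a finite-dimensional fibre: `projEPer_eq_projection`; `0` otherwise). [cite: Balaban1985BackgroundPropagators, (3.21)–(3.22) p.394; Balaban1985RegularSpaces, p.77] -/
def projEPer : perSub (𝔸 := 𝔸) (d := d) P →ₗ[ℝ] perSub (𝔸 := 𝔸) (d := d) P :=
  if h : IsCompl (rangeSubPer P L m η Λs U₀) ((formPer τ P).orthogonal (rangeSubPer P L m η Λs U₀)) then
    (rangeSubPer P L m η Λs U₀).projection ((formPer τ P).orthogonal (rangeSubPer P L m η Λs U₀)) h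
  else 0

/-- **`R(U₀)` ON ALL FUNCTIONS `ℤᵈ → 𝔸`**: periodise by representatives, project, read back as a function. [cite: Balaban1985BackgroundPropagators, (3.21)–(3.22) p.394; Balaban1985RegularSpaces, p.77 («Ω₀ = T_η»)] -/
def projRPer (f : Site d → 𝔸) : Site d → 𝔸 :=
  ((projEPer τ P L m η Λs U₀ ⟨perRestrict P f, perRestrict_mem_perSub P f⟩ : perSub (𝔸 := 𝔸) (d := d) P) : Site d → 𝔸)

variable {τ P}

/-- **THE COMPLEMENT EXISTS** for a faithful Hermitian trace on a finite-dimensional fibre and `P ≠ 0`: `L²(T_P, ·) = R ⊕ R^⊥` (Mathlib: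
`isCompl_orthogonal_of_restrict_nondegenerate`). [cite: Balaban1985BackgroundPropagators, (3.21)–(3.22) p.394] -/
theorem isCompl_rangeSubPer_orthogonal [FiniteDimensional ℝ 𝔸] [NeZero P] (hτs : ∀ a : 𝔸, τ (star a) = starRingEnd ℂ (τ a))
    (hτp : ∀ a : 𝔸, a ≠ 0 → 0 < (τ (star a * a)).re) :
    IsCompl (rangeSubPer P L m η Λs U₀) ((formPer τ P).orthogonal (rangeSubPer P L m η Λs U₀)) := by
  haveI := finiteDimensional_perSub (𝔸 := 𝔸) (d := d) P
  exact LinearMap.BilinForm.isCompl_orthogonal_of_restrict_nondegenerate (formPer_isSymm τ P hτs).isRefl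
    (restrict_formPer_nondegenerate τ P hτp _)

/-- `R(U₀)` IS the projection onto `R` along `R^⊥` under the `τ`-hypotheses. [cite: Balaban1985BackgroundPropagators, (3.21)–(3.22) p.394] -/
theorem projEPer_eq_projection [FiniteDimensional ℝ 𝔸] [NeZero P] (hτs : ∀ a : 𝔸, τ (star a) = starRingEnd ℂ (τ a))
    (hτp : ∀ a : 𝔸, a ≠ 0 → 0 < (τ (star a * a)).re) :
    projEPer τ P L m η Λs U₀ = (rangeSubPer P L m η Λs U₀).projection ((formPer τ P).orthogonal (rangeSubPer P L m η Λs U₀))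
      (isCompl_rangeSubPer_orthogonal L m η Λs U₀ hτs hτp) := by
  rw [projEPer, dif_pos (isCompl_rangeSubPer_orthogonal L m η Λs U₀ hτs hτp)]

/-- **`R(U₀)f = 0` FOR `f ⊥ R`** ((3.22): the minimiser is `λ₀ = 0`). [cite: Balaban1985BackgroundPropagators, (3.22) p.394] -/
theorem projEPer_apply_of_mem_orthogonal [FiniteDimensional ℝ 𝔸] [NeZero P] (hτs : ∀ a : 𝔸, τ (star a) = starRingEnd ℂ (τ a))
    (hτp : ∀ a : 𝔸, a ≠ 0 → 0 < (τ (star a * a)).re) {f : perSub (𝔸 := 𝔸) (d := d) P}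
    (hf : f ∈ (formPer τ P).orthogonal (rangeSubPer P L m η Λs U₀)) : projEPer τ P L m η Λs U₀ f = 0 := by
  rw [projEPer_eq_projection L m η Λs U₀ hτs hτp]
  exact Submodule.projection_apply_of_mem_right _ hf

/-- **`R(U₀)w = w` FOR `w ∈ R`** (a genuine projection). [cite: Balaban1985BackgroundPropagators, (3.21)–(3.22) p.394] -/
theorem projEPer_apply_of_mem_range [FiniteDimensional ℝ 𝔸] [NeZero P] (hτs : ∀ a : 𝔸, τ (star a) = starRingEnd ℂ (τ a))
    (hτp : ∀ a : 𝔸, a ≠ 0 → 0 < (τ (star a * a)).re) {w : perSub (𝔸 := 𝔸) (d := d) P}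
    (hw : w ∈ rangeSubPer P L m η Λs U₀) : projEPer τ P L m η Λs U₀ w = w := by
  rw [projEPer_eq_projection L m η Λs U₀ hτs hτp]
  exact Submodule.projection_apply_of_mem_left _ hw

/-- `R(U₀)f ∈ R` for every `f`. [cite: Balaban1985BackgroundPropagators, (3.22) p.394 («Rf = Δ^η_Uλ₀»)] -/
theorem projEPer_apply_mem_range [FiniteDimensional ℝ 𝔸] [NeZero P] (hτs : ∀ a : 𝔸, τ (star a) = starRingEnd ℂ (τ a))
    (hτp : ∀ a : 𝔸, a ≠ 0 → 0 < (τ (star a * a)).re) (f : perSub (𝔸 := 𝔸) (d := d) P) :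
    projEPer τ P L m η Λs U₀ f ∈ rangeSubPer P L m η Λs U₀ := by
  rw [projEPer_eq_projection L m η Λs U₀ hτs hτp]
  exact Submodule.projection_apply_mem _ f

/-- **`R(U₀)` IS IDEMPOTENT** (`R² = R`). [cite: Balaban1985BackgroundPropagators, (3.21) p.394 («an orthogonal projection»)] -/
theorem projEPer_isIdempotentElem [FiniteDimensional ℝ 𝔸] [NeZero P] (hτs : ∀ a : 𝔸, τ (star a) = starRingEnd ℂ (τ a))
    (hτp : ∀ a : 𝔸, a ≠ 0 → 0 < (τ (star a * a)).re) : IsIdempotentElem (projEPer τ P L m η Λs U₀) := by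
  rw [projEPer_eq_projection L m η Λs U₀ hτs hτp]
  exact Submodule.isIdempotentElem_projection _

/-- **`R(U₀)` IS SYMMETRIC for the pairing** (`⟨Rf, g⟩ = ⟨f, Rg⟩` — an ORTHOGONAL projection: `f − Rf ⊥ R`). [cite: Balaban1985BackgroundPropagators, (3.21) p.394 («an orthogonal projection»)] -/
theorem formPer_projEPer_symm [FiniteDimensional ℝ 𝔸] [NeZero P] (hτs : ∀ a : 𝔸, τ (star a) = starRingEnd ℂ (τ a))
    (hτp : ∀ a : 𝔸, a ≠ 0 → 0 < (τ (star a * a)).re) (f g : perSub (𝔸 := 𝔸) (d := d) P) :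
    formPer τ P (projEPer τ P L m η Λs U₀ f) g = formPer τ P f (projEPer τ P L m η Λs U₀ g) := by
  have hc := isCompl_rangeSubPer_orthogonal (P := P) (τ := τ) L m η Λs U₀ hτs hτp
  set W := rangeSubPer (𝔸 := 𝔸) P L m η Λs U₀ with hW
  set R := projEPer τ P L m η Λs U₀ with hR
  have hRf : R f ∈ W := projEPer_apply_mem_range L m η Λs U₀ hτs hτp f
  have hRg : R g ∈ W := projEPer_apply_mem_range L m η Λs U₀ hτs hτp g
  -- `x − Rx ∈ R^⊥`
  have hres : ∀ x : perSub (𝔸 := 𝔸) (d := d) P, x - R x ∈ (formPer τ P).orthogonal W := by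
    intro x
    rw [hR, projEPer_eq_projection L m η Λs U₀ hτs hτp]
    exact Submodule.sub_projection_mem hc x
  have hsym := formPer_isSymm (d := d) τ P hτs
  have h1 : formPer τ P (R f) g = formPer τ P (R f) (R g) := by
    have h0 : formPer τ P (R f) (g - R g) = 0 := (LinearMap.BilinForm.mem_orthogonal_iff.1 (hres g)) _ hRf
    rw [map_sub] at h0
    exact (sub_eq_zero.1 h0)
  have h2 : formPer τ P f (R g) = formPer τ P (R f) (R g) := by
    have h0 : formPer τ P (R g) (f - R f) = 0 := (LinearMap.BilinForm.mem_orthogonal_iff.1 (hres f)) _ hRg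
    rw [map_sub, sub_eq_zero] at h0
    -- h0 : formPer (R g) f = formPer (R g) (R f)
    rw [← hsym.eq (R g) f, h0, hsym.eq (R g) (R f)]
  rw [h1, h2]

/-- **`R(U₀)(Δ^η_{U₀}λ) = Δ^η_{U₀}λ`** for `λ ∈ N_𝔤^per(Q′(U₀))` and `P`-periodic `U₀` (the generators are fixed). [cite: Balaban1985BackgroundPropagators, (3.21)–(3.22) p.394] -/
theorem projEPer_covLap_of_mem_gaugeNullPer [FiniteDimensional ℝ 𝔸] [NeZero P] (hτs : ∀ a : 𝔸, τ (star a) = starRingEnd ℂ (τ a))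
    (hτp : ∀ a : 𝔸, a ≠ 0 → 0 < (τ (star a * a)).re) (hU : IsPeriodic P U₀) {lam : Site d → 𝔸} (hlam : lam ∈ gaugeNullPer P L m Λs U₀) :
    projEPer τ P L m η Λs U₀ ⟨covLap η U₀ lam, covLap_mem_perSub hU hlam.2.1⟩ = ⟨covLap η U₀ lam, covLap_mem_perSub hU hlam.2.1⟩ :=
  projEPer_apply_of_mem_range L m η Λs U₀ hτs hτp (Submodule.subset_span (covLap_mem_rangeGenPer hU hlam))

end Projection

/-! ## §4  A6 ∕ non-vacuity: the abelian fibre -/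

section Witness

variable (P L m : ℕ) (η : ℝ) (Λs : ℕ → Set (Site d)) (U₀ : Site d → Fin d → ℂˣ)

/-- **A6 ∕ NON-VACUITY OF THE `τ`-HYPOTHESES — THE ABELIAN FIBRE ON THE TORUS**: for `𝔸 = ℂ` (the `U(1)` case) with `τ = id` the two trace properties hold
(`star = conj`, `Re(ā a) = |a|² > 0`), so for every `P ≠ 0` the decomposition `L²(T_P, ·) = R ⊕ R^⊥` holds with NO hypothesis left and `projEPer` IS the
orthogonal projection of (3.21). [cite: Balaban1985BackgroundPropagators, (3.21)–(3.22) p.394; Balaban1985RegularSpaces, p.77 («Ω₀ = T_η»)] -/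
theorem isCompl_rangeSubPer_orthogonal_complex [NeZero P] :
    IsCompl (rangeSubPer P L m η Λs U₀)
      ((formPer (LinearMap.id : ℂ →ₗ[ℂ] ℂ) P).orthogonal (rangeSubPer P L m η Λs U₀)) := by
  refine isCompl_rangeSubPer_orthogonal (𝔸 := ℂ) (τ := LinearMap.id) L m η Λs U₀ (fun a => rfl) (fun a ha => ?_)
  rw [LinearMap.id_apply, Complex.star_def, ← Complex.normSq_eq_conj_mul_self, Complex.ofReal_re]
  exact Complex.normSq_pos.2 ha

/-- A6, continued: on the abelian fibre `R(U₀)` on the torus is an idempotent (`R² = R`) for every `P ≠ 0`, every `U₀`, with no hypothesis left.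
[cite: Balaban1985BackgroundPropagators, (3.21) p.394 («an orthogonal projection»)] -/
theorem projEPer_isIdempotentElem_complex [NeZero P] :
    IsIdempotentElem (projEPer (LinearMap.id : ℂ →ₗ[ℂ] ℂ) P L m η Λs U₀) := by
  refine projEPer_isIdempotentElem (𝔸 := ℂ) (τ := LinearMap.id) L m η Λs U₀ (fun a => rfl) (fun a ha => ?_)
  rw [LinearMap.id_apply, Complex.star_def, ← Complex.normSq_eq_conj_mul_self, Complex.ofReal_re]
  exact Complex.normSq_pos.2 ha

end Witness

end Literature.MathematicalPhysics.QuantumFieldTheory.Balaban1983to89.B9Eq321LandauProjectionZdPer
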